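import Mathlib
import HarnessLib.Audit
import Summits.PneNP.PneNP.Theorems.PstarUnionCovers
import Summits.PneNP.PneNP.Theorems.PstarGSystemFreeVar

/-!
# The union lemma's third pair: the PIN `A₀ + A₁` and the triple of covers (ROUND-24, memo §14.3 «UNION FORM»)

FRONTIER range-avoidance ladder, rung F-N3, ROUND 24 (cell `pnp-ideate`, planner memo `r24/CORE-BOUND-NOTES.md` §14.3; prover-1 g15 analysis after the
refutation of the stand-alone tips chain (`PstarTipsChainRefutation`); restricted-model proof complexity — nothing here bears on `P` versus `NP`).

In a union-terminal core (`PstarUnion.UnionTerminal I r y J₀ A₀ A₁ w₂`) both `A₀` and `A₁ = A₀ + L` are constant (off target) on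
`V = Sol(J₀) ∩ {w₂}`, hence so is the monomial-free LINEAR form `L = A₀ + A₁` (`unionTerminal_pin`: the generalised pin of FRESH ERASE).  The pair
`(L ≠ pin, w₂)` is a THIRD infeasible pair on `J₀`, and its cover `R` (outputs whose deletion releases the pin) contains the symmetric difference of the
two given covers (`release_of_cover_sdiff`): every output lies in at least two of `P₀, P₁, R`.  Consequences proved here:

* `terminal_pin` — if every output releases the pin (`R = J₀`), then `J₀` is TERMINAL (`PstarCoreBoundTargets.Terminal`) for the linear pair
  `(L, w₂)`, whose monomials are those of `w₂` alone;
* `card_le_five_of_released` — hence `#J₀ ≤ 5` by the landed chain (privates unread for `w₂`'s monomials suffices);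
* `unionFive_of_disjoint_covers` — in particular the union lemma holds whenever NO output is necessary for both pairs (`P₀ ∩ P₁ = ∅`).

What remains of `UnionFive`: outputs necessary for BOTH pairs that do NOT release the pin.
-/

set_option linter.dupNamespace false -- `Summit.PneNP.PneNP.…`: summit = sub-problem name (D-0017 single-conjunct layout)

open Finset Literature.Computability.Complexity
open scoped symmDiff
open Summit.PneNP.PneNP.Theorems.PstarTyped (Typed)
open Summit.PneNP.PneNP.Theorems.PstarSALevel (varSet bdry BoundaryExpanding SimpleOverlap)
open Summit.PneNP.PneNP.Theorems.PstarGapOneAll (gval)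
open Summit.PneNP.PneNP.Theorems.PstarCoreBound (XorClosed)
open Summit.PneNP.PneNP.Theorems.PstarChordRepair (IsChord)
open Summit.PneNP.PneNP.Theorems.PstarChordBridgeCotree (Peelable)
open Summit.PneNP.PneNP.Theorems.PstarChordBridgeTools (privs)
open Summit.PneNP.PneNP.Theorems.PstarCoreBoundTargets (Terminal card_le_five_of_terminal')
open Summit.PneNP.PneNP.Theorems.PstarGSystemFreeVar (gval_symmDiff)
open Summit.PneNP.PneNP.Theorems.PstarUnion (SatPair UnionTerminal UnionFive)

namespace Summit.PneNP.PneNP.Theorems.PstarUnionPin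

variable {n m : ℕ}

/-- the PIN PAIR's first constraint: the monomial-free linear form `L = A₀ + A₁` with the RELEASED target `¬(t₀ + t₁)` -/
def pinK (A₀ A₁ : Finset (Fin n) × Finset (Fin m) × Bool) : Finset (Fin n) × Finset (Fin m) × Bool :=
  (A₀.1 ∆ A₁.1, ∅, !(xor A₀.2.2 A₁.2.2))

/-- `L = A₀ + A₁` pointwise (same monomials cancel). -/
theorem gval_pin (I : LocalMap 4 n m) {A₀ A₁ : Finset (Fin n) × Finset (Fin m) × Bool} (hG : A₁.2.1 = A₀.2.1) (x : Fin n → Bool) :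
    gval I (pinK A₀ A₁).1 (pinK A₀ A₁).2.1 x = xor (gval I A₀.1 A₀.2.1 x) (gval I A₁.1 A₁.2.1 x) := by
  have h := gval_symmDiff I A₀.1 A₁.1 A₀.2.1 A₁.2.1 x
  rw [hG, symmDiff_self] at h
  rw [hG]
  exact h

/-- **The generalised pin**: on `Sol(J₀) ∩ {w₂}` the linear form `L = A₀ + A₁` is the constant `t₀ + t₁`. -/
theorem unionTerminal_pin (I : LocalMap 4 n m) {r : ℕ} {y : Fin m → Bool} {J₀ : Finset (Fin m)}
    {A₀ A₁ w₂ : Finset (Fin n) × Finset (Fin m) × Bool} (hU : UnionTerminal I r y J₀ A₀ A₁ w₂) {x : Fin n → Bool}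
    (hx : ∀ j ∈ J₀, I.eval x j = y j) (hw : gval I w₂.1 w₂.2.1 x = w₂.2.2) :
    gval I (pinK A₀ A₁).1 (pinK A₀ A₁).2.1 x = xor A₀.2.2 A₁.2.2 := by
  obtain ⟨-, -, -, hG, -, -, -, -, h₀, h₁, -⟩ := hU
  rw [gval_pin I hG]
  have e₀ : gval I A₀.1 A₀.2.1 x ≠ A₀.2.2 := fun h => h₀ ⟨x, hx, h, hw⟩
  have e₁ : gval I A₁.1 A₁.2.1 x ≠ A₁.2.2 := fun h => h₁ ⟨x, hx, h, hw⟩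
  revert e₀ e₁
  cases gval I A₀.1 A₀.2.1 x <;> cases gval I A₁.1 A₁.2.1 x <;> cases A₀.2.2 <;> cases A₁.2.2 <;> simp

/-- **An output in one cover but not the other RELEASES the pin**: the pin pair is feasible over `J₀ ∖ f`. -/
theorem release_of_cover_sdiff (I : LocalMap 4 n m) {y : Fin m → Bool} {J₀ : Finset (Fin m)}
    {A₀ A₁ w₂ : Finset (Fin n) × Finset (Fin m) × Bool} (hG : A₁.2.1 = A₀.2.1) {f : Fin m}
    (h₀ : SatPair I y (J₀.erase f) A₀ w₂) (h₁ : ¬ SatPair I y (J₀.erase f) A₁ w₂) : SatPair I y (J₀.erase f) (pinK A₀ A₁) w₂ := by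
  obtain ⟨x, hx, hA, hw⟩ := h₀
  refine ⟨x, hx, ?_, hw⟩
  rw [gval_pin I hG, hA]
  have e₁ : gval I A₁.1 A₁.2.1 x ≠ A₁.2.2 := fun h => h₁ ⟨x, hx, h, hw⟩
  show xor A₀.2.2 (gval I A₁.1 A₁.2.1 x) = !(xor A₀.2.2 A₁.2.2)
  revert e₁
  cases gval I A₁.1 A₁.2.1 x <;> cases A₀.2.2 <;> cases A₁.2.2 <;> simp

/-- The symmetric release. -/
theorem release_of_cover_sdiff' (I : LocalMap 4 n m) {y : Fin m → Bool} {J₀ : Finset (Fin m)}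
    {A₀ A₁ w₂ : Finset (Fin n) × Finset (Fin m) × Bool} (hG : A₁.2.1 = A₀.2.1) {f : Fin m}
    (h₀ : ¬ SatPair I y (J₀.erase f) A₀ w₂) (h₁ : SatPair I y (J₀.erase f) A₁ w₂) : SatPair I y (J₀.erase f) (pinK A₀ A₁) w₂ := by
  obtain ⟨x, hx, hA, hw⟩ := h₁
  refine ⟨x, hx, ?_, hw⟩
  rw [gval_pin I hG, hA]
  have e₀ : gval I A₀.1 A₀.2.1 x ≠ A₀.2.2 := fun h => h₀ ⟨x, hx, h, hw⟩
  show xor (gval I A₀.1 A₀.2.1 x) A₁.2.2 = !(xor A₀.2.2 A₁.2.2)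
  revert e₀
  cases gval I A₀.1 A₀.2.1 x <;> cases A₀.2.2 <;> cases A₁.2.2 <;> simp

/-- **Every output lies in two of the three covers**: if it does not release the pin, it is necessary for BOTH given pairs. -/
theorem both_covers_of_not_release (I : LocalMap 4 n m) {r : ℕ} {y : Fin m → Bool} {J₀ : Finset (Fin m)}
    {A₀ A₁ w₂ : Finset (Fin n) × Finset (Fin m) × Bool} (hU : UnionTerminal I r y J₀ A₀ A₁ w₂) {f : Fin m} (hf : f ∈ J₀)
    (hnr : ¬ SatPair I y (J₀.erase f) (pinK A₀ A₁) w₂) : SatPair I y (J₀.erase f) A₀ w₂ ∧ SatPair I y (J₀.erase f) A₁ w₂ := by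
  have hG := hU.2.2.2.1
  have hcov := hU.2.2.2.2.2.2.2.2.2.2 f hf
  by_contra h
  rw [not_and_or] at h
  rcases h with h | h
  · rcases hcov with h' | h'
    · exact h h'
    · exact hnr (release_of_cover_sdiff' I hG h h')
  · rcases hcov with h' | h'
    · exact hnr (release_of_cover_sdiff I hG h' h)
    · exact h h'

/-- **If every output releases the pin, `J₀` is TERMINAL for the linear pin pair `(L, w₂)`.** -/
theorem terminal_pin (I : LocalMap 4 n m) {r : ℕ} {y : Fin m → Bool} {J₀ : Finset (Fin m)}
    {A₀ A₁ w₂ : Finset (Fin n) × Finset (Fin m) × Bool} (hU : UnionTerminal I r y J₀ A₀ A₁ w₂)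
    (hrel : ∀ f ∈ J₀, SatPair I y (J₀.erase f) (pinK A₀ A₁) w₂) : Terminal I r y J₀ (pinK A₀ A₁) w₂ := by
  obtain ⟨hne, hX, hJr, hG, hd₀, hd₂, hr, hxor, h₀, h₁, hcov⟩ := id hU
  refine ⟨hne, hX, hJr, disjoint_empty_right _, hd₂, ?_, ?_, hrel⟩
  · refine (card_le_card ?_).trans hr
    show J₀ ∪ ∅ ∪ w₂.2.1 ⊆ J₀ ∪ A₀.2.1 ∪ w₂.2.1
    rw [union_empty]
    exact union_subset_union subset_union_left (Subset.refl _)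
  · rintro ⟨x, hx, hL, hw⟩
    have hpin := unionTerminal_pin I hU hx hw
    rw [hpin] at hL
    revert hL
    show xor A₀.2.2 A₁.2.2 = !(xor A₀.2.2 A₁.2.2) → False
    cases xor A₀.2.2 A₁.2.2 <;> simp

/-- **Hence at most five outputs when every output releases the pin** (the landed chain on the pin pair; privates unread for the monomials of `w₂`). -/
theorem card_le_five_of_released (I : LocalMap 4 n m) (hI : I.IsPure xorAndPred) (hT : Typed I) (hS : SimpleOverlap I) {r : ℕ}
    (hB : BoundaryExpanding r I) {y : Fin m → Bool} {J₀ : Finset (Fin m)} {A₀ A₁ w₂ : Finset (Fin n) × Finset (Fin m) × Bool}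
    (hU : UnionTerminal I r y J₀ A₀ A₁ w₂) (hrel : ∀ f ∈ J₀, SatPair I y (J₀.erase f) (pinK A₀ A₁) w₂)
    {F : Finset (Fin m)} (hF : F ⊆ J₀) (hP : Peelable I F) (hmax : ∀ F', F ⊆ F' → F' ⊆ J₀ → Peelable I F' → F' = F)
    (hchord : ∀ e ∈ J₀ \ F, IsChord I J₀ e) (hun : ∀ g ∈ w₂.2.1, ∀ v ∈ privs I (J₀ \ F), I.vars g 2 ≠ v ∧ I.vars g 3 ≠ v) :
    J₀.card ≤ 5 := by
  refine card_le_five_of_terminal' I hI hT hS hB y (terminal_pin I hU hrel) hF hP hmax hchord fun g hg => ?_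
  rcases mem_union.1 hg with h | h
  · exact absurd h (notMem_empty g)
  · exact hun g h

/-- **The union lemma when the covers are disjoint**: no output necessary for both pairs ⟹ every output releases the pin ⟹ `#J₀ ≤ 5`. -/
theorem unionFive_of_disjoint_covers (I : LocalMap 4 n m) (hI : I.IsPure xorAndPred) (hT : Typed I) (hS : SimpleOverlap I) {r : ℕ}
    (hB : BoundaryExpanding r I) {y : Fin m → Bool} {J₀ : Finset (Fin m)} {A₀ A₁ w₂ : Finset (Fin n) × Finset (Fin m) × Bool}
    (hU : UnionTerminal I r y J₀ A₀ A₁ w₂)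
    (hdisj : ∀ f ∈ J₀, ¬ (SatPair I y (J₀.erase f) A₀ w₂ ∧ SatPair I y (J₀.erase f) A₁ w₂))
    {F : Finset (Fin m)} (hF : F ⊆ J₀) (hP : Peelable I F) (hmax : ∀ F', F ⊆ F' → F' ⊆ J₀ → Peelable I F' → F' = F)
    (hchord : ∀ e ∈ J₀ \ F, IsChord I J₀ e) (hun : ∀ g ∈ w₂.2.1, ∀ v ∈ privs I (J₀ \ F), I.vars g 2 ≠ v ∧ I.vars g 3 ≠ v) :
    J₀.card ≤ 5 :=
  card_le_five_of_released I hI hT hS hB hU (fun f hf => by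
    by_contra hnr
    exact hdisj f hf (both_covers_of_not_release I hU hf hnr)) hF hP hmax hchord hun

end Summit.PneNP.PneNP.Theorems.PstarUnionPin
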